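import Literature.MathematicalPhysics.QuantumFieldTheory.Balaban1983to89.B13UrsellKPSeries
import Literature.MathematicalPhysics.QuantumFieldTheory.Dimock2011to13.TreeGraphSummation

/-!
# `Balaban1983to89.B13Eq240TreeGraph` — (2.39) ⇒ (2.40) ⇒ (2.41) of T. Bałaban, *Renormalization group approach to
lattice gauge field theories. II. Cluster expansions*, Commun. Math. Phys. **116**, 1–22 (1988),
doi:10.1007/bf01239022 [Balaban1988RG2Cluster] (cell paper B13), p. 21, BY THE PRINTED ROUTE *"repeat all the
considerations and bounds of the paper [26]"* ([26] = C. Cammarota, Commun. Math. Phys. **85** (1982) 517–528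
[Cammarota1982], §3) — the tree-graph inequality and the vertex-by-vertex tree summation, applied to the PRINTED
Ursell series (2.13)

statement-level skeleton of published theorems with citation tags; proofs where landed; nothing here is a claim about the Yang–Mills mass gap

PDF held: `paper:balaban1988-cmp116-rg-ii-cluster` (journal page = PDF page; pp. 20–21 read this session with
`lit read … --pages 20-21`) and `paper:doi-10-1007-bf01403502` (= [26], pp. 517–528, read this session).

WHAT IS REPRODUCED = SKELETON row **B13.Eq2.40** (with the sentences around it: (2.39) and (2.41)), unit
`lit-balaban-p24` (Phase-2 proof seat p24, gen 2; HOME `run/shared/lean/pub/lit-balaban/`).  The passage, p. 20 last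
paragraph – p. 21 [PDF 20–21], verbatim: *"The series (2.13), defining E^{(k+1)}(X), is estimated in the standard way,
each factor |H(Z)| is replaced by the right-hand side of (2.38) in the bound. Consider a term in the sum. We have a
product of n exponentials from (2.38). We extract the exponential exp(−δ½Lκd_{k+1}(Z_i)) from the i-th factor, and the
remaining product is estimated using (2.27), and the condition ∪Z_i = X, X is a connected domain. This yields*
  `|E^{(k+1)}(X)| ≤ exp(−(1 − 9δ)½Lκd_{k+1}(X)) exp(−5κ)
     · Σ_{n=1}^∞ (1/n!) Σ_{(Z₁,…,Z_n): ∪Z_i = X} |ρ^T(Z₁,…,Z_n)| Π_{i=1}^n C₃ε₁ exp 5κ exp(−δ½Lκd_{k+1}(Z_i)).`  (2.39)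
*To the above sum we can repeat all the considerations and bounds of the paper [26], for κ sufficiently large, and ε₁
sufficiently small. We obtain*
  `|E^{(k+1)}(X)| ≤ exp(−(1 − 9δ)½Lκd_{k+1}(X)) exp(−5κ)
     · Σ_{Z⊂X} C₃ε₁ exp 5κ exp(−½δLκd_{k+1}(Z)) O(1) exp 2(LM)⁻⁴|Z|.`                                 (2.40)
*The last sum is bounded by C₃ε₁ exp 5κ O(1)(LM)⁻⁴|X| ≤ C₃ε₁ exp 5κ O(1) exp(LM)⁻⁴|X|, and the last exponential
multiplied by exp(−½δLκd_{k+1}(X)) is bounded by 1. This yields*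
  `|E^{(k+1)}(X)| ≤ O(1)C₃ε₁ exp(−(1 − 10δ)½Lκd_{k+1}(X)).`                                          (2.41)

THE PRINTED ROUTE [26, §3, pp. 525–528] (read this session; the OCR of the displays is poor, the prose is legible):
(3.3)–(3.5) the root polymer `R₁ = R` of a sequence is split off; (3.6) the sum to estimate is
`Σ_{n≥2} (1/(n−1)!) Σ_{(R₂,…,R_n)} |φ^T(R₁,…,R_n)| |ζ(R₂)|⋯|ζ(R_n)|`; (3.7)–(3.8) *"φ^T(R₁,…,R_n) depends only on the
graph g(R₁,…,R_n)"*; Proposition p. 526 *"|φ(f)| ≤ N(f)"*, `N(f)` the number of trees contained in `f` (*"For the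
proof we refer to [10] or to [13, 14]"* = Penrose, Rota, Malyshev); (3.9) the exchange `Σ_f Σ_{t⊂f} = Σ_t Σ_{f⊃t}`
*"where the definition of w(t) is implicit in the last equation"*; p. 527 the sums vertex by vertex from the leaves,
*"We are so led to estimate the series Σ_{x∈R∈ℜ} |ζ(R)||R|^p for each nonnegative integer p"*, (3.11)
`w(t) ≤ … Π_i (d_i − 1)!`; the Cayley formula *"(n−2)!/Π(d_i−1)!"* [26, ref. 12] and (3.12) the sum over degree
sequences.  This is, step for step, the method of J. Dimock, *The renormalization group according to Balaban I*,
Rev. Math. Phys. **25** (2013) 1330010, App. B proof of Theorem 27 step 4 ([Cam82] is the first reference of that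
appendix), which the tree holds KERNEL-PROVED in `Dimock2011to13.UrsellTreeGraphBound` (the tree-graph inequality
`abs_hcUrsell_le_card_treeGraphs` = [26, Prop. p. 526]) and `Dimock2011to13.TreeGraphSummation` (`sum_compat_le` = the
vertex-by-vertex summation (3.9)–(3.11); `sum_forests_prod_card_children_factorial_le` = Cayley + (3.12)).  This file
TRANSPORTS that engine to the printed `ρ^T` of (2.12) (`B13MayerDecoupling.rhoT`; gen-1 bridge
`B13UrsellKP.rhoT_eq_hcUrsell`) and to the polymer system of (2.11) (incompatibility *"ζ(Z, Z′) = 0 if Z ∩ Z′ contains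
a cube, or a wall of a cube"*, footprint-local as in `B13Resummation.Geometry`: `reach`, `ν`), and then writes
(2.39) ⇒ (2.40) ⇒ (2.41) in the printed letters with "κ sufficiently large" and "ε₁ sufficiently small" EXPLICIT.

WHAT IS PROVED (0 sorry; every display over the abstract finite polymer catalogue of `B13FamilySum`/`B13Resummation`/
`B13UrsellKPSeries`: a finite type `P` of polymers = 𝐃_{k+1} at finite volume, footprints `cubes : P → Finset Cube`
= the LM-cubes, tree lengths `d`, a symmetric `{0,1}`-valued two-body function `ζ`).
* §1 `abs_rhoT_le_card_treeGraphs` ([26, Prop. p. 526] for the printed ρ^T), `sum_abs_rhoT_mul_prod_le` ([26]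
  (3.9)–(3.12): the order-`n` bound `Σ_{(Z_j)∈Q^n} |ρ^T| Π w(Z_j) ≤ A^n B (n−1)! 4^{n−1}` under the vertex and root
  hypotheses of `TreeGraphSummation.sum_compat_le` for the relation `ζ = 0`).
* §2 the vertex hypothesis from an ANCHORED exponential norm `Σ_{Z∋□} w(Z)e^{|Z|} ≤ Φ` and footprint-locality
  ([26] p. 527 *"Σ_{x∈R₂} Σ_{R₃∋x} …"*): `sum_rel_le_of_anchored`, `vertexHyp_of_anchored`; the order-`n` bound with
  the ROOT KEPT EXPLICIT ([26] (3.3)–(3.5)): `sum_abs_rhoT_mul_prod_le_anchored`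
  (`≤ (νΦ)^{n−1} · [Σ_{Z∈Q} w(Z)e^{|Z|}] · (n−1)! 4^{n−1}`).
* §3 *"divide by n! and sum over n"*: the majorant series of (2.13)/(2.39) `absSeries213` (coefficients `absTerm213`),
  `absTerm213_le`, `absSeries213_le` (`≤ 2 Σ_{Z⊂X} w(Z)e^{|Z|}` once `8νΦ ≤ 1`), `summable_absTerm213`.
* The PRINTED DISPLAYS in the printed letters — (2.40) (`ineq240`), the sentence after it, (2.41) (`ineq241_of_239`),
  (2.39) itself (`ineq239`) and the chained `norm_ursellSeries213_le` — are the sibling `B13Eq240Printed` (imports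
  this file); the bridge to `B13.CammarotaStepWith` (abstract `StepData`) is planned as `B13Eq240Step`.
  [v1.1 pointer update: the displays, the margin-3/2 convergence of (2.12)/(2.13) (`ursellSeries213_eq_locE_of_small`:
  the printed (2.13) = the tree's Kotecký–Preiss object `B13Resummation.locE`) and the `StepData` bridge
  (`cammarotaStepWith_of_treeGraph`, `cammarotaStepWith_of_treeGraph_locE`, `…_R22gen`, `bound118_of_treeGraph`,
  `deliverables_of_chainWith_treeGraph`) all landed in the sibling `B13Eq240Printed` (there is no `B13Eq240Step`); the
  fold owner's printed-letter `Prop` twin `B13Ineq240.Ineq240` (r10) is derived from `B13.Bound238` by this route in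
  `B13Eq240Bridge.ineq240_of_bound238`.]
Relation to the tree: the KP certificate `B13Resummation.norm_locE_le_of_small` (Kotecký–Preiss, anchored at ONE cube,
no `|X|`) remains the kernel route of record for (2.41); this file and its sibling are the [26]-route the paper
prints, with its `|X|` and its second `δ`.

v1.1 (same unit; DOCFIX — module docstring only, every declaration byte-identical): sibling pointers updated after
`B13Eq240Printed` (p246907, v1.1 p247186) and `B13Eq240Bridge` (p247102) landed.
-/

open Finset

noncomputable section

namespace Literature.MathematicalPhysics.QuantumFieldTheory.Balaban1983to89.B13Eq240TreeGraph

open Literature.MathematicalPhysics.QuantumFieldTheory.Balaban1983to89.B13MayerDecoupling (rhoT rhoT_zero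
  ursellSeries213)
open Literature.MathematicalPhysics.QuantumFieldTheory.Balaban1983to89.B13UrsellKP (idxGraph idxGraph_symm
  rhoT_eq_hcUrsell)
open Literature.MathematicalPhysics.QuantumFieldTheory.Balaban1983to89.B13FamilySum (inside mem_inside Ineq126
  VolBound Ineq227 coveringFamilies mem_coveringFamilies sum_inside_le_card_mul)
open Literature.Probability.LatticeModels (hcUrsell)
open Literature.Combinatorics.Enumerative (IsForestOn forests mem_forests children)
open Literature.MathematicalPhysics.QuantumFieldTheory.Dimock2011to13.UrsellTreeGraphBound (treeGraphs
  abs_hcUrsell_le_card_treeGraphs)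
open Literature.MathematicalPhysics.QuantumFieldTheory.Dimock2011to13.TreeGraphSummation (sum_compat_le
  sum_forests_prod_card_children_factorial_le)

variable {P : Type*} {ζ : P → P → ℝ}

/-! ## §1 [26, Prop. p. 526 and (3.9)–(3.12)] for the printed `ρ^T` of (2.12) -/

section TreeGraph

/-- **[26, Proposition p. 526]** *"|φ(f)| ≤ N(f)"* (`N(f)` = the number of trees contained in the graph `f`) for the
printed Ursell coefficient of (2.12): for a symmetric `{0,1}`-valued `ζ` and `n ≥ 1`,
`|ρ^T(Z₁,…,Z_n)| ≤ #{spanning trees of the graph {ζ(Z_i,Z_j) = 0} on {1,…,n}}` (trees as parent maps towards the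
first index; tree engine `UrsellTreeGraphBound.abs_hcUrsell_le_card_treeGraphs` via gen-1 `B13UrsellKP.rhoT_eq_hcUrsell`).
[cite: Balaban1988RG2Cluster, (2.39)–(2.40) p.21] -/
theorem abs_rhoT_le_card_treeGraphs (h01 : ∀ Z Z', ζ Z Z' = 0 ∨ ζ Z Z' = 1) (hsymm : ∀ Z Z', ζ Z Z' = ζ Z' Z)
    {n : ℕ} [NeZero n] (Z : Fin n → P) :
    |rhoT ζ Z| ≤ ((treeGraphs (idxGraph ζ Z) (univ : Finset (Fin n)) (0 : Fin n)).card : ℝ) := by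
  rw [rhoT_eq_hcUrsell h01 hsymm (Nat.pos_of_ne_zero (NeZero.ne n)) Z]
  exact_mod_cast abs_hcUrsell_le_card_treeGraphs (idxGraph_symm hsymm Z) univ (Finset.mem_univ (0 : Fin n))

/-- **[26, (3.9)–(3.12)]: THE ORDER-`n` BOUND** for the printed `ρ^T`: for a finite set `Q` of polymers, weights
`w ≥ 0`, volumes `vol ≥ 0` and constants `A, B ≥ 0` with the VERTEX HYPOTHESIS
`Σ_{Z∈Q: ζ(Z,Z′)=0} w(Z)vol(Z)^k ≤ k!·A·vol(Z′)` (p. 527 *"Σ_{x∈R∈ℜ} |ζ(R)||R|^p for each nonnegative integer p"*)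
and the ROOT HYPOTHESIS `Σ_{Z∈Q} w(Z)vol(Z)^k ≤ k!·A·B`:
`Σ_{(Z₁,…,Z_n)∈Q^n} |ρ^T(Z₁,…,Z_n)| Π_j w(Z_j) ≤ A^n·B·(n−1)!·4^{n−1}` — the tree-graph inequality, the exchange
(3.9) `Σ_f Σ_{t⊂f} = Σ_t Σ_{f⊃t}`, the summation vertex by vertex (3.11) (`TreeGraphSummation.sum_compat_le`) and
Cayley's formula with (3.12) (`sum_forests_prod_card_children_factorial_le`). [cite: Balaban1988RG2Cluster, (2.39)–(2.40) p.21] -/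
theorem sum_abs_rhoT_mul_prod_le (h01 : ∀ Z Z', ζ Z Z' = 0 ∨ ζ Z Z' = 1) (hsymm : ∀ Z Z', ζ Z Z' = ζ Z' Z)
    {Q : Finset P} {w vol : P → ℝ} (hw : ∀ X ∈ Q, 0 ≤ w X) (hvol : ∀ X ∈ Q, 0 ≤ vol X) {A B : ℝ} (hA : 0 ≤ A)
    (hB : 0 ≤ B)
    (H1 : ∀ X' ∈ Q, ∀ k : ℕ, ∑ X ∈ Q with ζ X X' = 0, w X * vol X ^ k ≤ k.factorial * A * vol X')
    (H0 : ∀ k : ℕ, ∑ X ∈ Q, w X * vol X ^ k ≤ k.factorial * A * B) {n : ℕ} [NeZero n] :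
    ∑ Z ∈ Fintype.piFinset (fun _ : Fin n => Q), |rhoT ζ Z| * ∏ j, w (Z j) ≤
      A ^ n * B * ((n - 1).factorial * 4 ^ (n - 1) : ℕ) := by
  -- |ρ^T| ≤ #treeGraphs, written as a sum of indicators over all tree graphs rooted at `0`
  have h1 : ∀ Z ∈ Fintype.piFinset (fun _ : Fin n => Q), |rhoT ζ Z| * ∏ j, w (Z j) ≤
      ∑ t ∈ forests (univ : Finset (Fin n)) {0},
        (if ∀ u : Fin n, u ≠ 0 → ζ (Z u) (Z (t u)) = 0 then ∏ j, w (Z j) * vol (Z j) ^ (0 : ℕ) else 0) := by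
    intro Z hZ
    have hnn : 0 ≤ ∏ j, w (Z j) := Finset.prod_nonneg fun j _ => hw _ (Fintype.mem_piFinset.1 hZ j)
    calc |rhoT ζ Z| * ∏ j, w (Z j)
        ≤ (treeGraphs (idxGraph ζ Z) univ (0 : Fin n)).card * ∏ j, w (Z j) :=
          mul_le_mul_of_nonneg_right (abs_rhoT_le_card_treeGraphs h01 hsymm Z) hnn
      _ = ∑ t ∈ forests univ {0},
            (if ∀ u : Fin n, u ≠ 0 → ζ (Z u) (Z (t u)) = 0 then ∏ j, w (Z j) * vol (Z j) ^ (0 : ℕ) else 0) := by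
          rw [treeGraphs, Finset.card_filter, Nat.cast_sum, Finset.sum_mul]
          refine Finset.sum_congr rfl fun t _ => ?_
          simp only [idxGraph, Finset.mem_erase, Finset.mem_univ, and_true, pow_zero, mul_one]
          by_cases hc : ∀ u : Fin n, u ≠ 0 → ζ (Z u) (Z (t u)) = 0
          · rw [if_pos hc, if_pos hc]; simp
          · rw [if_neg hc, if_neg hc]; simp
  have h4 := sum_forests_prod_card_children_factorial_le (univ : Finset (Fin n)) (Finset.mem_univ (0 : Fin n))
  rw [Finset.card_univ, Fintype.card_fin] at h4
  calc ∑ Z ∈ Fintype.piFinset (fun _ : Fin n => Q), |rhoT ζ Z| * ∏ j, w (Z j)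
      ≤ ∑ Z ∈ Fintype.piFinset (fun _ : Fin n => Q), ∑ t ∈ forests (univ : Finset (Fin n)) {0},
          (if ∀ u : Fin n, u ≠ 0 → ζ (Z u) (Z (t u)) = 0 then ∏ j, w (Z j) * vol (Z j) ^ (0 : ℕ) else 0) :=
        Finset.sum_le_sum h1
    _ = ∑ t ∈ forests (univ : Finset (Fin n)) {0}, ∑ Z ∈ Fintype.piFinset (fun _ : Fin n => Q),
          (if ∀ u : Fin n, u ≠ 0 → ζ (Z u) (Z (t u)) = 0 then ∏ j, w (Z j) * vol (Z j) ^ (0 : ℕ) else 0) :=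
        Finset.sum_comm
    _ ≤ ∑ t ∈ forests (univ : Finset (Fin n)) {0},
          A ^ n * B * ∏ u : Fin n, (((fun _ => 0 : Fin n → ℕ) u + (children univ {0} u t).card).factorial : ℝ) :=
        Finset.sum_le_sum fun t ht =>
          sum_compat_le (ov := fun X X' => ζ X X' = 0) (mem_forests.1 ht) hw hvol hA H1 H0 (fun _ => 0)
    _ = A ^ n * B * ((∑ t ∈ forests (univ : Finset (Fin n)) {0},
          ∏ u : Fin n, (children univ {0} u t).card.factorial : ℕ) : ℝ) := by
        rw [← Finset.mul_sum]
        simp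
    _ ≤ A ^ n * B * ((n - 1).factorial * 4 ^ (n - 1) : ℕ) :=
        mul_le_mul_of_nonneg_left (Nat.cast_le.2 h4) (mul_nonneg (pow_nonneg hA n) hB)

end TreeGraph

/-! ## §2 The vertex hypothesis from an anchored exponential norm; the root kept explicit -/

section Anchored

variable {Cube : Type*} [DecidableEq Cube] {Q : Finset P} {cubes reach : P → Finset Cube} {ν : ℝ}

/-- `x^k ≤ k!·e^x` for `x ≥ 0` ([26] p. 527: the estimate of `Σ |ζ(R)||R|^p` through `p!`). [folklore] -/
private theorem pow_le_factorial_mul_exp {x : ℝ} (hx : 0 ≤ x) (k : ℕ) :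
    x ^ k ≤ k.factorial * Real.exp x := by
  have h := Real.pow_div_factorial_le_exp (x := x) hx k
  rwa [div_le_iff₀ (by positivity), mul_comm] at h

/-- FOOTPRINT LOCALITY turns an ANCHORED bound into a bound over the incompatible polymers ([26] p. 527: the sum over
`R₃` with `R₃ ∩ R₂ ≠ ∅` is split over the points `x ∈ R₂`; here *"Z ∩ Z′ contains a cube, or a wall of a cube"*
(2.11) forces `Z` to contain a cube of `reach Z′`, `#reach Z′ ≤ ν|Z′|`): `Σ_{Z∈Q: ζ(Z,Z′)=0} f(Z) ≤ Φ·ν·|Z′|`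
whenever `Σ_{Z∈Q: q∈Z} f(Z) ≤ Φ` for every cube `q`. [cite: Balaban1988RG2Cluster, (2.39)–(2.40) p.21] -/
theorem sum_rel_le_of_anchored {f : P → ℝ} (hf : ∀ X ∈ Q, 0 ≤ f X) {Φ : ℝ} (hΦ : 0 ≤ Φ)
    (hanch : ∀ q : Cube, ∑ X ∈ Q with q ∈ cubes X, f X ≤ Φ)
    (hloc : ∀ Z Z', ζ Z' Z = 0 → ∃ q ∈ reach Z, q ∈ cubes Z')
    (hreach : ∀ Z, ((reach Z).card : ℝ) ≤ ν * (cubes Z).card) (X' : P) :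
    ∑ X ∈ Q with ζ X X' = 0, f X ≤ Φ * ν * (cubes X').card := by
  -- each incompatible `X` is counted at least once among the anchors `q ∈ reach X'`
  have h1 : ∀ X ∈ Q.filter (fun X => ζ X X' = 0),
      f X ≤ ∑ q ∈ reach X', if q ∈ cubes X then f X else 0 := by
    intro X hX
    obtain ⟨hXQ, hrel⟩ := Finset.mem_filter.1 hX
    obtain ⟨q, hq, hqX⟩ := hloc X' X hrel
    calc f X = ∑ q ∈ ({q} : Finset Cube), if q ∈ cubes X then f X else 0 := by simp [hqX]
      _ ≤ ∑ q ∈ reach X', if q ∈ cubes X then f X else 0 :=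
          Finset.sum_le_sum_of_subset_of_nonneg (Finset.singleton_subset_iff.2 hq)
            (fun q _ _ => by split_ifs <;> simp [hf X hXQ])
  calc ∑ X ∈ Q with ζ X X' = 0, f X
      ≤ ∑ X ∈ Q with ζ X X' = 0, ∑ q ∈ reach X', if q ∈ cubes X then f X else 0 := Finset.sum_le_sum h1
    _ ≤ ∑ X ∈ Q, ∑ q ∈ reach X', if q ∈ cubes X then f X else 0 :=
        Finset.sum_le_sum_of_subset_of_nonneg (Finset.filter_subset _ _)
          (fun X hX _ => Finset.sum_nonneg fun q _ => by split_ifs <;> simp [hf X hX])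
    _ = ∑ q ∈ reach X', ∑ X ∈ Q with q ∈ cubes X, f X := by
        rw [Finset.sum_comm]
        exact Finset.sum_congr rfl fun q _ => (Finset.sum_filter _ _).symm
    _ ≤ ∑ q ∈ reach X', Φ := Finset.sum_le_sum fun q _ => hanch q
    _ = Φ * (reach X').card := by rw [Finset.sum_const, nsmul_eq_mul, mul_comm]
    _ ≤ Φ * (ν * (cubes X').card) := mul_le_mul_of_nonneg_left (hreach X') hΦ
    _ = Φ * ν * (cubes X').card := by ring

/-- THE VERTEX HYPOTHESIS of `sum_abs_rhoT_mul_prod_le` (volume `|Z|` = number of cubes, `A = νΦ`) from an ANCHORED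
EXPONENTIAL NORM `Σ_{Z∈Q: q∈Z} w(Z)e^{|Z|} ≤ Φ` ([26] p. 527: `|R|^p ≤ p!·(…)` and the split over points; (2.11)'s
footprint locality). [cite: Balaban1988RG2Cluster, (2.39)–(2.40) p.21] -/
theorem vertexHyp_of_anchored {w : P → ℝ} (hw : ∀ X ∈ Q, 0 ≤ w X) {Φ : ℝ} (hΦ : 0 ≤ Φ)
    (hanch : ∀ q : Cube, ∑ X ∈ Q with q ∈ cubes X, w X * Real.exp ((cubes X).card : ℝ) ≤ Φ)
    (hloc : ∀ Z Z', ζ Z' Z = 0 → ∃ q ∈ reach Z, q ∈ cubes Z')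
    (hreach : ∀ Z, ((reach Z).card : ℝ) ≤ ν * (cubes Z).card) :
    ∀ X' ∈ Q, ∀ k : ℕ, ∑ X ∈ Q with ζ X X' = 0, w X * ((cubes X).card : ℝ) ^ k ≤
      k.factorial * (ν * Φ) * ((cubes X').card : ℝ) := by
  intro X' _ k
  have hf : ∀ X ∈ Q, 0 ≤ w X * Real.exp ((cubes X).card : ℝ) := fun X hX =>
    mul_nonneg (hw X hX) (Real.exp_nonneg _)
  calc ∑ X ∈ Q with ζ X X' = 0, w X * ((cubes X).card : ℝ) ^ k
      ≤ ∑ X ∈ Q with ζ X X' = 0, k.factorial * (w X * Real.exp ((cubes X).card : ℝ)) :=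
        Finset.sum_le_sum fun X hX => by
          calc w X * ((cubes X).card : ℝ) ^ k ≤ w X * (k.factorial * Real.exp ((cubes X).card : ℝ)) :=
                mul_le_mul_of_nonneg_left (pow_le_factorial_mul_exp (Nat.cast_nonneg _) k)
                  (hw X (Finset.mem_filter.1 hX).1)
            _ = k.factorial * (w X * Real.exp ((cubes X).card : ℝ)) := by ring
    _ = k.factorial * ∑ X ∈ Q with ζ X X' = 0, w X * Real.exp ((cubes X).card : ℝ) := by rw [Finset.mul_sum]
    _ ≤ k.factorial * (Φ * ν * (cubes X').card) :=
        mul_le_mul_of_nonneg_left (sum_rel_le_of_anchored hf hΦ hanch hloc hreach X') (Nat.cast_nonneg _)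
    _ = k.factorial * (ν * Φ) * ((cubes X').card : ℝ) := by ring

/-- **THE ORDER-`n` BOUND WITH THE ROOT POLYMER KEPT** ([26] (3.3)–(3.6): the first polymer of the sequence is split off
and only `R₂, …, R_n` are resummed): for a symmetric `{0,1}`-valued, footprint-local `ζ`, weights `w ≥ 0` on `Q` with
the anchored exponential norm `Σ_{Z∈Q: q∈Z} w(Z)e^{|Z|} ≤ Φ`,
`Σ_{(Z_j)∈Q^n} |ρ^T(Z₁,…,Z_n)| Π_j w(Z_j) ≤ (νΦ)^{n−1} · [Σ_{Z∈Q} w(Z)e^{|Z|}] · (n−1)!·4^{n−1}`.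
[cite: Balaban1988RG2Cluster, (2.39)–(2.40) p.21] -/
theorem sum_abs_rhoT_mul_prod_le_anchored (h01 : ∀ Z Z', ζ Z Z' = 0 ∨ ζ Z Z' = 1)
    (hsymm : ∀ Z Z', ζ Z Z' = ζ Z' Z) {w : P → ℝ} (hw : ∀ X ∈ Q, 0 ≤ w X) {Φ : ℝ} (hΦ : 0 ≤ Φ) (hν : 0 ≤ ν)
    (hanch : ∀ q : Cube, ∑ X ∈ Q with q ∈ cubes X, w X * Real.exp ((cubes X).card : ℝ) ≤ Φ)
    (hloc : ∀ Z Z', ζ Z' Z = 0 → ∃ q ∈ reach Z, q ∈ cubes Z')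
    (hreach : ∀ Z, ((reach Z).card : ℝ) ≤ ν * (cubes Z).card) {n : ℕ} [NeZero n] :
    ∑ Z ∈ Fintype.piFinset (fun _ : Fin n => Q), |rhoT ζ Z| * ∏ j, w (Z j) ≤
      (ν * Φ) ^ (n - 1) * (∑ X ∈ Q, w X * Real.exp ((cubes X).card : ℝ)) *
        ((n - 1).factorial * 4 ^ (n - 1) : ℕ) := by
  set R : ℝ := ∑ X ∈ Q, w X * Real.exp ((cubes X).card : ℝ) with hR
  have hR0 : 0 ≤ R := Finset.sum_nonneg fun X hX => mul_nonneg (hw X hX) (Real.exp_nonneg _)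
  have hn1 : n - 1 + 1 = n := Nat.succ_pred_eq_of_ne_zero (NeZero.ne n)
  -- the root hypothesis `Σ w vol^k ≤ k!·R`
  have hroot : ∀ k : ℕ, ∑ X ∈ Q, w X * ((cubes X).card : ℝ) ^ k ≤ k.factorial * R := by
    intro k
    rw [hR, Finset.mul_sum]
    refine Finset.sum_le_sum fun X hX => ?_
    calc w X * ((cubes X).card : ℝ) ^ k ≤ w X * (k.factorial * Real.exp ((cubes X).card : ℝ)) :=
          mul_le_mul_of_nonneg_left (pow_le_factorial_mul_exp (Nat.cast_nonneg _) k) (hw X hX)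
      _ = k.factorial * (w X * Real.exp ((cubes X).card : ℝ)) := by ring
  -- for every `ε > 0` run the tree summation with `A = νΦ + ε > 0`, `B = R / A`
  have key : ∀ ε : ℝ, 0 < ε → ∑ Z ∈ Fintype.piFinset (fun _ : Fin n => Q), |rhoT ζ Z| * ∏ j, w (Z j) ≤
      (ν * Φ + ε) ^ (n - 1) * R * ((n - 1).factorial * 4 ^ (n - 1) : ℕ) := by
    intro ε hε
    have hApos : 0 < ν * Φ + ε := by positivity
    have H1 : ∀ X' ∈ Q, ∀ k : ℕ, ∑ X ∈ Q with ζ X X' = 0, w X * ((cubes X).card : ℝ) ^ k ≤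
        k.factorial * (ν * Φ + ε) * ((cubes X').card : ℝ) := fun X' hX' k =>
      (vertexHyp_of_anchored hw hΦ hanch hloc hreach X' hX' k).trans
        (mul_le_mul_of_nonneg_right
          (mul_le_mul_of_nonneg_left (le_add_of_nonneg_right hε.le) (Nat.cast_nonneg _)) (Nat.cast_nonneg _))
    have H0 : ∀ k : ℕ, ∑ X ∈ Q, w X * ((cubes X).card : ℝ) ^ k ≤
        k.factorial * (ν * Φ + ε) * (R / (ν * Φ + ε)) := fun k => by
      rw [mul_assoc, mul_div_cancel₀ _ hApos.ne']
      exact hroot k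
    have h := sum_abs_rhoT_mul_prod_le h01 hsymm hw (fun _ _ => Nat.cast_nonneg _) hApos.le
      (div_nonneg hR0 hApos.le) H1 H0 (n := n)
    calc ∑ Z ∈ Fintype.piFinset (fun _ : Fin n => Q), |rhoT ζ Z| * ∏ j, w (Z j)
        ≤ (ν * Φ + ε) ^ n * (R / (ν * Φ + ε)) * ((n - 1).factorial * 4 ^ (n - 1) : ℕ) := h
      _ = (ν * Φ + ε) ^ (n - 1) * R * ((n - 1).factorial * 4 ^ (n - 1) : ℕ) := by
          have hpow : (ν * Φ + ε) ^ n = (ν * Φ + ε) ^ (n - 1) * (ν * Φ + ε) := by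
            rw [← pow_succ, hn1]
          rw [hpow]
          field_simp
  -- let `ε → 0`
  have hlim : Filter.Tendsto (fun ε : ℝ => (ν * Φ + ε) ^ (n - 1) * R * ((n - 1).factorial * 4 ^ (n - 1) : ℕ))
      (nhdsWithin 0 (Set.Ioi 0)) (nhds ((ν * Φ + 0) ^ (n - 1) * R * ((n - 1).factorial * 4 ^ (n - 1) : ℕ))) :=
    ((((tendsto_const_nhds.add Filter.tendsto_id).pow (n - 1)).mul_const R).mul_const _).mono_left
      nhdsWithin_le_nhds
  rw [add_zero] at hlim
  exact ge_of_tendsto hlim (eventually_nhdsWithin_of_forall fun ε hε => key ε hε)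

end Anchored

/-! ## §3 "divide by n! and sum over n": the majorant series of (2.13)/(2.39) -/

section Series

variable [Fintype P] {Cube : Type*} [DecidableEq Cube]

/-- The order-`n` coefficient of the series in (2.39) p. 21: `Σ_{(Z₁,…,Z_n): ∪Z_i = X} |ρ^T(Z₁,…,Z_n)| Π_i w(Z_i)`
(the sequences of (2.13) whose union of footprints is exactly `X`; in (2.39) `w(Z) = C₃ε₁ exp 5κ exp(−δ½Lκd_{k+1}(Z))`).
[cite: Balaban1988RG2Cluster, (2.39) p.21] -/
def absTerm213 (ζ : P → P → ℝ) (w : P → ℝ) (cubes : P → Finset Cube) (n : ℕ) (X : Finset Cube) : ℝ :=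
  ∑ Z ∈ (Finset.univ : Finset (Fin n → P)).filter
      (fun Z => (Finset.univ : Finset (Fin n)).biUnion (fun i => cubes (Z i)) = X),
    |rhoT ζ Z| * ∏ i, w (Z i)

/-- The series in (2.39) p. 21: `Σ_{n=1}^∞ (1/n!) Σ_{(Z₁,…,Z_n): ∪Z_i = X} |ρ^T(Z₁,…,Z_n)| Π_i w(Z_i)` (a `tsum`; the
`n = 0` term vanishes, `absTerm213_zero`). [cite: Balaban1988RG2Cluster, (2.39) p.21] -/
def absSeries213 (ζ : P → P → ℝ) (w : P → ℝ) (cubes : P → Finset Cube) (X : Finset Cube) : ℝ :=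
  ∑' n : ℕ, ((n.factorial : ℝ)⁻¹ * absTerm213 ζ w cubes n X)

/-- `absTerm213 ≥ 0` for `w ≥ 0`. [cite: Balaban1988RG2Cluster, (2.39) p.21] (elementary API for (2.39)) -/
theorem absTerm213_nonneg (ζ : P → P → ℝ) {w : P → ℝ} (hw : ∀ Z, 0 ≤ w Z) (cubes : P → Finset Cube) (n : ℕ)
    (X : Finset Cube) : 0 ≤ absTerm213 ζ w cubes n X :=
  Finset.sum_nonneg fun _ _ => mul_nonneg (abs_nonneg _) (Finset.prod_nonneg fun _ _ => hw _)

/-- The empty sequence contributes nothing (`ρ^T` of no polymer is `0`), so the series starts at `n = 1` as printed.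
[cite: Balaban1988RG2Cluster, (2.39) p.21] (elementary API for (2.39)) -/
theorem absTerm213_zero (ζ : P → P → ℝ) (w : P → ℝ) (cubes : P → Finset Cube) (X : Finset Cube) :
    absTerm213 ζ w cubes 0 X = 0 := by
  unfold absTerm213
  exact Finset.sum_eq_zero fun Z _ => by rw [rhoT_zero]; simp

/-- *"Σ_{(R₁,…,R_n)∈ℜ^n, R_i⊂Λ} ≤ …"* ([26] after (3.2)): the sequences with `∪Z_i = X` are among the sequences of
polymers INSIDE `X`, so the order-`n` coefficient of (2.39) is at most the full order-`n` sum over `(inside X)^n`.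
[cite: Balaban1988RG2Cluster, (2.39)–(2.40) p.21] -/
theorem absTerm213_le_sum_inside (ζ : P → P → ℝ) {w : P → ℝ} (hw : ∀ Z, 0 ≤ w Z) (cubes : P → Finset Cube)
    (n : ℕ) (X : Finset Cube) :
    absTerm213 ζ w cubes n X ≤
      ∑ Z ∈ Fintype.piFinset (fun _ : Fin n => inside (Finset.univ : Finset P) cubes X),
        |rhoT ζ Z| * ∏ i, w (Z i) := by
  unfold absTerm213
  refine Finset.sum_le_sum_of_subset_of_nonneg (fun Z hZ => ?_) fun _ _ _ =>
    mul_nonneg (abs_nonneg _) (Finset.prod_nonneg fun _ _ => hw _)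
  rw [Finset.mem_filter] at hZ
  rw [Fintype.mem_piFinset]
  intro i
  rw [mem_inside]
  refine ⟨Finset.mem_univ _, ?_⟩
  rw [← hZ.2]
  exact Finset.subset_biUnion_of_mem (fun i => cubes (Z i)) (Finset.mem_univ i)

variable {cubes reach : P → Finset Cube} {ν : ℝ}

/-- **THE ORDER-`n` COEFFICIENT OF (2.39), BOUNDED À LA [26]**: for `n ≥ 1`, with `Q = inside X` and an anchored
exponential norm `Φ` for the weights on `Q`,
`(2.39)_n ≤ (νΦ)^{n−1} · [Σ_{Z⊂X} w(Z)e^{|Z|}] · (n−1)!·4^{n−1}`. [cite: Balaban1988RG2Cluster, (2.39)–(2.40) p.21] -/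
theorem absTerm213_le (h01 : ∀ Z Z', ζ Z Z' = 0 ∨ ζ Z Z' = 1) (hsymm : ∀ Z Z', ζ Z Z' = ζ Z' Z) {w : P → ℝ}
    (hw : ∀ Z, 0 ≤ w Z) {Φ : ℝ} (hΦ : 0 ≤ Φ) (hν : 0 ≤ ν) {X : Finset Cube}
    (hanch : ∀ q : Cube, ∑ Z ∈ inside (Finset.univ : Finset P) cubes X with q ∈ cubes Z,
      w Z * Real.exp ((cubes Z).card : ℝ) ≤ Φ)
    (hloc : ∀ Z Z', ζ Z' Z = 0 → ∃ q ∈ reach Z, q ∈ cubes Z')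
    (hreach : ∀ Z, ((reach Z).card : ℝ) ≤ ν * (cubes Z).card) {n : ℕ} [NeZero n] :
    absTerm213 ζ w cubes n X ≤
      (ν * Φ) ^ (n - 1) * (∑ Z ∈ inside (Finset.univ : Finset P) cubes X, w Z * Real.exp ((cubes Z).card : ℝ)) *
        ((n - 1).factorial * 4 ^ (n - 1) : ℕ) :=
  (absTerm213_le_sum_inside ζ hw cubes n X).trans
    (sum_abs_rhoT_mul_prod_le_anchored h01 hsymm (fun Z _ => hw Z) hΦ hν hanch hloc hreach)

/-- The `n`-th term of the series (2.39) (index shifted by one) is dominated by a geometric sequence: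
`(1/(n+1)!)·(2.39)_{n+1} ≤ [Σ_{Z⊂X} w(Z)e^{|Z|}]·(4νΦ)^n` ([26] p. 528 *"summing the series (3.5)"*).
[cite: Balaban1988RG2Cluster, (2.39)–(2.40) p.21] -/
theorem absTerm213_succ_div_le (h01 : ∀ Z Z', ζ Z Z' = 0 ∨ ζ Z Z' = 1) (hsymm : ∀ Z Z', ζ Z Z' = ζ Z' Z)
    {w : P → ℝ} (hw : ∀ Z, 0 ≤ w Z) {Φ : ℝ} (hΦ : 0 ≤ Φ) (hν : 0 ≤ ν) {X : Finset Cube}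
    (hanch : ∀ q : Cube, ∑ Z ∈ inside (Finset.univ : Finset P) cubes X with q ∈ cubes Z,
      w Z * Real.exp ((cubes Z).card : ℝ) ≤ Φ)
    (hloc : ∀ Z Z', ζ Z' Z = 0 → ∃ q ∈ reach Z, q ∈ cubes Z')
    (hreach : ∀ Z, ((reach Z).card : ℝ) ≤ ν * (cubes Z).card) (n : ℕ) :
    (((n + 1).factorial : ℝ))⁻¹ * absTerm213 ζ w cubes (n + 1) X ≤
      (∑ Z ∈ inside (Finset.univ : Finset P) cubes X, w Z * Real.exp ((cubes Z).card : ℝ)) * (4 * (ν * Φ)) ^ n := by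
  set R : ℝ := ∑ Z ∈ inside (Finset.univ : Finset P) cubes X, w Z * Real.exp ((cubes Z).card : ℝ) with hR
  have hR0 : 0 ≤ R := Finset.sum_nonneg fun Z _ => mul_nonneg (hw Z) (Real.exp_nonneg _)
  have h := absTerm213_le h01 hsymm hw hΦ hν hanch hloc hreach (n := n + 1)
  simp only [Nat.add_sub_cancel] at h
  calc (((n + 1).factorial : ℝ))⁻¹ * absTerm213 ζ w cubes (n + 1) X
      ≤ (((n + 1).factorial : ℝ))⁻¹ * ((ν * Φ) ^ n * R * ((n.factorial * 4 ^ n : ℕ) : ℝ)) :=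
        mul_le_mul_of_nonneg_left h (by positivity)
    _ = ((n.factorial : ℝ) / (n + 1).factorial) * (R * (4 * (ν * Φ)) ^ n) := by
        push_cast
        ring
    _ ≤ 1 * (R * (4 * (ν * Φ)) ^ n) :=
        mul_le_mul_of_nonneg_right
          (div_le_one_of_le₀ (by exact_mod_cast Nat.factorial_le (Nat.le_succ n)) (by positivity))
          (by positivity)
    _ = R * (4 * (ν * Φ)) ^ n := one_mul _

/-- **CONVERGENCE OF THE SERIES (2.39)** (p. 20: *"The above lemma implies that sufficient conditions for convergence
of the series (2.12), (2.13) are satisfied, see [26, 67, 25, 50]"*): under "ε₁ sufficiently small" := `8νΦ ≤ 1` the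
terms `(1/n!)·(2.39)_n` are summable. [cite: Balaban1988RG2Cluster, (2.39)–(2.40) p.21] -/
theorem summable_absTerm213 (h01 : ∀ Z Z', ζ Z Z' = 0 ∨ ζ Z Z' = 1) (hsymm : ∀ Z Z', ζ Z Z' = ζ Z' Z)
    {w : P → ℝ} (hw : ∀ Z, 0 ≤ w Z) {Φ : ℝ} (hΦ : 0 ≤ Φ) (hν : 0 ≤ ν) {X : Finset Cube}
    (hanch : ∀ q : Cube, ∑ Z ∈ inside (Finset.univ : Finset P) cubes X with q ∈ cubes Z,
      w Z * Real.exp ((cubes Z).card : ℝ) ≤ Φ)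
    (hloc : ∀ Z Z', ζ Z' Z = 0 → ∃ q ∈ reach Z, q ∈ cubes Z')
    (hreach : ∀ Z, ((reach Z).card : ℝ) ≤ ν * (cubes Z).card) (hsmall : 8 * (ν * Φ) ≤ 1) :
    Summable fun n : ℕ => ((n.factorial : ℝ))⁻¹ * absTerm213 ζ w cubes n X := by
  refine (summable_nat_add_iff 1).1 ?_
  refine Summable.of_nonneg_of_le (fun n => mul_nonneg (by positivity) (absTerm213_nonneg ζ hw cubes _ X))
    (fun n => absTerm213_succ_div_le h01 hsymm hw hΦ hν hanch hloc hreach n) ?_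
  refine Summable.mul_left _ (summable_geometric_of_lt_one (by positivity) ?_)
  linarith

/-- **[26]'s CONCLUSION FOR THE SERIES (2.39)** ((1.20)/(3.5) of [26]; here with Dimock's constants): under
`8νΦ ≤ 1`, `Σ_{n≥1} (1/n!) Σ_{(Z_i): ∪Z_i = X} |ρ^T| Π w(Z_i) ≤ 2 · Σ_{Z⊂X} w(Z) e^{|Z|}` — the sum over the ROOT
polymer `Z ⊂ X` with the factor `O(1)e^{|Z|}` that (2.40) prints as `O(1) exp 2(LM)⁻⁴|Z|`.
[cite: Balaban1988RG2Cluster, (2.40) p.21] -/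
theorem absSeries213_le (h01 : ∀ Z Z', ζ Z Z' = 0 ∨ ζ Z Z' = 1) (hsymm : ∀ Z Z', ζ Z Z' = ζ Z' Z)
    {w : P → ℝ} (hw : ∀ Z, 0 ≤ w Z) {Φ : ℝ} (hΦ : 0 ≤ Φ) (hν : 0 ≤ ν) {X : Finset Cube}
    (hanch : ∀ q : Cube, ∑ Z ∈ inside (Finset.univ : Finset P) cubes X with q ∈ cubes Z,
      w Z * Real.exp ((cubes Z).card : ℝ) ≤ Φ)
    (hloc : ∀ Z Z', ζ Z' Z = 0 → ∃ q ∈ reach Z, q ∈ cubes Z')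
    (hreach : ∀ Z, ((reach Z).card : ℝ) ≤ ν * (cubes Z).card) (hsmall : 8 * (ν * Φ) ≤ 1) :
    absSeries213 ζ w cubes X ≤
      2 * ∑ Z ∈ inside (Finset.univ : Finset P) cubes X, w Z * Real.exp ((cubes Z).card : ℝ) := by
  set R : ℝ := ∑ Z ∈ inside (Finset.univ : Finset P) cubes X, w Z * Real.exp ((cubes Z).card : ℝ) with hR
  have hR0 : 0 ≤ R := Finset.sum_nonneg fun Z _ => mul_nonneg (hw Z) (Real.exp_nonneg _)
  have hθ0 : 0 ≤ 4 * (ν * Φ) := by positivity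
  have hθ : 4 * (ν * Φ) ≤ 1 / 2 := by linarith
  have hθ1 : 4 * (ν * Φ) < 1 := by linarith
  have hs := summable_absTerm213 h01 hsymm hw hΦ hν hanch hloc hreach hsmall
  have hgeo : Summable fun n : ℕ => R * (4 * (ν * Φ)) ^ n :=
    Summable.mul_left _ (summable_geometric_of_lt_one hθ0 hθ1)
  unfold absSeries213
  rw [hs.tsum_eq_zero_add, absTerm213_zero, mul_zero, zero_add]
  calc ∑' n : ℕ, (((n + 1).factorial : ℝ))⁻¹ * absTerm213 ζ w cubes (n + 1) X
      ≤ ∑' n : ℕ, R * (4 * (ν * Φ)) ^ n :=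
        ((summable_nat_add_iff 1).2 hs).tsum_le_tsum
          (fun n => absTerm213_succ_div_le h01 hsymm hw hΦ hν hanch hloc hreach n) hgeo
    _ = R * (1 - 4 * (ν * Φ))⁻¹ := by rw [tsum_mul_left, tsum_geometric_of_lt_one hθ0 hθ1]
    _ ≤ R * 2 := by
        refine mul_le_mul_of_nonneg_left ?_ hR0
        rw [inv_le_comm₀ (by linarith) (by norm_num)]
        linarith
    _ = 2 * R := mul_comm _ _

/-- The same geometric domination for the FULL order-`(n+1)` sum over the polymers inside `X` (no condition
`∪Z_i = X`; this is the majorant of the order-`(n+1)` term of (2.12) restricted to `X`, used for the absolute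
convergence of (2.12)/(2.13) *"see [26, 67, 25, 50]"*): `(1/n!)·Σ_{(Z_j)∈(inside X)^{n+1}} |ρ^T| Π w ≤
[Σ_{Z⊂X} w(Z)e^{|Z|}]·(4νΦ)^n`. [cite: Balaban1988RG2Cluster, (2.39)–(2.40) p.21] -/
theorem sum_inside_succ_div_le (h01 : ∀ Z Z', ζ Z Z' = 0 ∨ ζ Z Z' = 1) (hsymm : ∀ Z Z', ζ Z Z' = ζ Z' Z)
    {w : P → ℝ} (hw : ∀ Z, 0 ≤ w Z) {Φ : ℝ} (hΦ : 0 ≤ Φ) (hν : 0 ≤ ν) {X : Finset Cube}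
    (hanch : ∀ q : Cube, ∑ Z ∈ inside (Finset.univ : Finset P) cubes X with q ∈ cubes Z,
      w Z * Real.exp ((cubes Z).card : ℝ) ≤ Φ)
    (hloc : ∀ Z Z', ζ Z' Z = 0 → ∃ q ∈ reach Z, q ∈ cubes Z')
    (hreach : ∀ Z, ((reach Z).card : ℝ) ≤ ν * (cubes Z).card) (n : ℕ) :
    ((n.factorial : ℝ))⁻¹ *
        ∑ Z ∈ Fintype.piFinset (fun _ : Fin (n + 1) => inside (Finset.univ : Finset P) cubes X),
          |rhoT ζ Z| * ∏ i, w (Z i) ≤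
      (∑ Z ∈ inside (Finset.univ : Finset P) cubes X, w Z * Real.exp ((cubes Z).card : ℝ)) * (4 * (ν * Φ)) ^ n := by
  set R : ℝ := ∑ Z ∈ inside (Finset.univ : Finset P) cubes X, w Z * Real.exp ((cubes Z).card : ℝ) with hR
  have h := sum_abs_rhoT_mul_prod_le_anchored h01 hsymm (fun Z _ => hw Z) hΦ hν hanch hloc hreach (n := n + 1)
  simp only [Nat.add_sub_cancel] at h
  have hfact : (0 : ℝ) < n.factorial := by positivity
  calc ((n.factorial : ℝ))⁻¹ *
        ∑ Z ∈ Fintype.piFinset (fun _ : Fin (n + 1) => inside (Finset.univ : Finset P) cubes X),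
          |rhoT ζ Z| * ∏ i, w (Z i)
      ≤ ((n.factorial : ℝ))⁻¹ * ((ν * Φ) ^ n * R * ((n.factorial * 4 ^ n : ℕ) : ℝ)) :=
        mul_le_mul_of_nonneg_left h (by positivity)
    _ = R * (4 * (ν * Φ)) ^ n := by
        push_cast
        field_simp
        ring

end Series

end Literature.MathematicalPhysics.QuantumFieldTheory.Balaban1983to89.B13Eq240TreeGraph
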